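import Summits.MatrixMultiplication.OmegaCensus.STPP211TFirstReflectA

/-!
# ω-census, `(2,1,1)^k` T-first kernel engine — reflection B: lane reading, kill pattern, cut, update, class patterns

HONEST FRAMING (pub-omega census; verbatim): lottery ticket; floor = certified bounds/negative ranges.
Census STRUCTURE bookkeeping of the STPP track (seat pub-omega-stpp-1, gen 38; STRUCTURE row B5, the threshold column
`T1(H) = max {k : (2,1,1)^k ⊆ H}`), not progress on `ω`: small patterns in small groups bound no exponent.

Second reflection file for `STPP211TFirstEngine.lean` (`Nat.testBit` semantics, no groups yet): reading a lane through its
sentinel bit (`laneVal`), the kill pattern of a placement (`((EPl · 2^a) >>> n) &&& lown` = every lane of `EPl` rotated by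
`a`), the pair cut, the salted state update (blind above bit `64`), the extraction of the patterns of one class from `EPup`,
and the meaning of the pattern builders `dMask` / `ndMask` / `epOf` / `epAll` (one direction: a set bit names a difference
of two listed codes).

References: H. Cohn, R. Kleinberg, B. Szegedy, C. Umans, *Group-theoretic algorithms for matrix multiplication*, FOCS 2005
(arXiv:math/0511460), Def. 5.1.  Desk record: pub-omega HOME `pub-omega-stpp-1-g38/`.
-/

namespace Summit.MatrixMultiplication.OmegaCensus

namespace STPP211T

open STPP211Neg
open Literature.Computability.Complexity (div_mod_block)
open Summit.MatrixMultiplication.OmegaCensus.T1Z2p5 (testBit_lowMask)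
open Literature.Barriers.RiemannHypothesis.TuranCheck (beq_true_iff)

/-! ## 4. Reading a lane, the kill pattern, the pair cut, the update, the pattern of a class -/

section Ops

variable {n K : ℕ} (units : List ℕ)

/-- Below bit `64` the lane constants are clear. -/
theorem testBit_lown_low {i : ℕ} (hi : i < 64) : (mkTC n K units).lown.testBit i = false := by
  rw [mkTC_lown, shiftLeft_eq', Nat.testBit_shiftLeft]; simp; omega

/-- Below bit `64` the sentinel word is clear. -/
theorem testBit_sent_low {i : ℕ} (hi : i < 64) : (mkTC n K units).sent.testBit i = false := by
  rw [mkTC_sent, shiftLeft_eq', Nat.testBit_shiftLeft]; simp; omega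

/-- Every position `≥ 64` is `64 + l·W + y` with `y < W` (`W = 2n > 0`); if it is `< 64 + K·W` then `l < K`. -/
theorem pos_cases (hn : 0 < n) {i : ℕ} (hi : 64 ≤ i) :
    ∃ l y, y < 2 * n ∧ i = 64 + l * (2 * n) + y := by
  refine ⟨(i - 64) / (2 * n), (i - 64) % (2 * n), Nat.mod_lt _ (by omega), ?_⟩
  have := Nat.div_add_mod (i - 64) (2 * n)
  rw [Nat.mul_comm] at this; omega

/-- `lown` above the lanes is clear. -/
theorem testBit_lown_high {l y : ℕ} (hl : K ≤ l) (hy : y < 2 * n) :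
    (mkTC n K units).lown.testBit (64 + l * (2 * n) + y) = false := by
  have hW : 0 < 2 * n := by omega
  have hv : lowMask n < 2 ^ (2 * n) := lt_of_lt_of_le (lowMask_lt n) (Nat.pow_le_pow_right Nat.two_pos (by omega))
  rw [mkTC_lown, shiftLeft_eq', Nat.testBit_shiftLeft, testBit_repLanes _ _ _ hW hv,
    show 64 + l * (2 * n) + y - 64 = l * (2 * n) + y by omega]
  have : ¬ (l * (2 * n) + y < K * (2 * n)) := by
    have : K * (2 * n) ≤ l * (2 * n) := Nat.mul_le_mul_right _ hl
    omega
  simp [this]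

/-- **Reading a lane.** For the sentinel bit `sb = 2^{64 + lW + n}`: bit `y` of `laneVal c M sb` is bit `64 + lW + y` of `M`
for `y < n`, and no higher bit is set. -/
theorem testBit_laneVal (M : ℕ) (l y : ℕ) :
    (laneVal (mkTC n K units) M (2 ^ (64 + l * (2 * n) + n))).testBit y =
      (decide (y < n) && M.testBit (64 + l * (2 * n) + y)) := by
  unfold laneVal
  rw [mkTC_n, mkTC_fulln, land_eq, Nat.testBit_land, shiftRight_eq', Nat.shiftRight_eq_div_pow,
    Nat.pow_div (by omega) Nat.two_pos, show 64 + l * (2 * n) + n - n = 64 + l * (2 * n) by omega, div_eq',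
    Nat.testBit_div_two_pow, testBit_lowMask, Bool.and_comm]
  congr 2; omega

/-- **The kill pattern of a placement** `((EPl · 2^a) >>> n) &&& lown` at a lane position: lane `l'` of `EPl` rotated by `a`
(read in the doubled lane at offset `y + n − a`), content positions only. -/
theorem testBit_kill (EPl a : ℕ) (ha : a ≤ n) {l' y : ℕ} (hl' : l' < K) (hy : y < 2 * n) :
    (Nat.land (Nat.shiftRight (Nat.mul EPl (2 ^ a)) (mkTC n K units).n) (mkTC n K units).lown).testBit
        (64 + l' * (2 * n) + y) =
      (decide (y < n) && EPl.testBit (64 + l' * (2 * n) + (y + n - a))) := by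
  rw [land_eq, Nat.testBit_land, testBit_lown units hl' hy, shiftRight_eq', Nat.testBit_shiftRight, mkTC_n, mul_eq',
    Nat.testBit_mul_two_pow, decide_eq_true (show a ≤ n + (64 + l' * (2 * n) + y) by omega), Bool.true_and,
    Bool.and_comm]
  by_cases hyn : y < n
  · rw [show n + (64 + l' * (2 * n) + y) - a = 64 + l' * (2 * n) + (y + n - a) by omega]
  · simp [hyn]

/-- The kill pattern has no bit at a sentinel, above the lanes, or below `64`. -/
theorem testBit_kill_off (EPl a i : ℕ)
    (hi : i < 64 ∨ (∃ l' y, y < 2 * n ∧ i = 64 + l' * (2 * n) + y ∧ (n ≤ y ∨ K ≤ l'))) :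
    (Nat.land (Nat.shiftRight (Nat.mul EPl (2 ^ a)) (mkTC n K units).n) (mkTC n K units).lown).testBit i = false := by
  rw [land_eq, Nat.testBit_land]
  rcases hi with hi | ⟨l', y, hy, rfl, hoff⟩
  · rw [testBit_lown_low units hi, Bool.and_false]
  · rcases Nat.lt_or_ge l' K with hl' | hl'
    · rw [testBit_lown units hl' hy]
      have : ¬ y < n := by rcases hoff with h | h <;> omega
      simp [this]
    · rw [testBit_lown_high units hl' hy, Bool.and_false]

/-- **The pair cut** `(2L − 1) · 2^{64+lW}` (`L = 2^a`, `a < n`) at a lane position: lane `l`, codes `≤ a`. -/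
theorem testBit_cut {a l l' y : ℕ} (ha : a < n) (hy : y < 2 * n) :
    (Nat.mul (Nat.sub (Nat.add (2 ^ a) (2 ^ a)) 1) (Nat.shiftRight (2 ^ (64 + l * (2 * n) + n)) (mkTC n K units).n)).testBit
        (64 + l' * (2 * n) + y) = decide (l' = l ∧ y ≤ a) := by
  rw [mul_eq', sub_eq', add_eq', mkTC_n, shiftRight_eq', Nat.shiftRight_eq_div_pow, Nat.pow_div (by omega) Nat.two_pos,
    show 64 + l * (2 * n) + n - n = 64 + l * (2 * n) by omega, show (2 : ℕ) ^ a + 2 ^ a = 2 ^ (a + 1) by rw [pow_succ]; omega,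
    Nat.testBit_mul_two_pow, Nat.testBit_two_pow_sub_one]
  rcases Nat.lt_trichotomy l' l with h | h | h
  · have h1 : ¬ (64 + l * (2 * n) ≤ 64 + l' * (2 * n) + y) := by
      have : (l' + 1) * (2 * n) ≤ l * (2 * n) := Nat.mul_le_mul_right _ h
      rw [Nat.add_mul, Nat.one_mul] at this; omega
    have h2 : ¬ (l' = l) := by omega
    simp [h1, h2]
  · subst h
    by_cases hya : y ≤ a
    · simp [hya]
    · simp [hya]
  · have hle : l * (2 * n) + 2 * n ≤ l' * (2 * n) := by
      have : (l + 1) * (2 * n) ≤ l' * (2 * n) := Nat.mul_le_mul_right _ h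
      rwa [Nat.add_mul, Nat.one_mul] at this
    have h1 : 64 + l * (2 * n) ≤ 64 + l' * (2 * n) + y := by omega
    have h2 : ¬ (64 + l' * (2 * n) + y - (64 + l * (2 * n)) < a + 1) := by omega
    have h3 : ¬ (l' = l) := by omega
    simp [h1, h2, h3]

/-- The pair cut has no bit below `64`. -/
theorem testBit_cut_low {a l i : ℕ} (hi : i < 64) :
    (Nat.mul (Nat.sub (Nat.add (2 ^ a) (2 ^ a)) 1) (Nat.shiftRight (2 ^ (64 + l * (2 * n) + n)) (mkTC n K units).n)).testBit
        i = false := by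
  rw [mul_eq', mkTC_n, shiftRight_eq', Nat.shiftRight_eq_div_pow, Nat.pow_div (by omega) Nat.two_pos,
    show 64 + l * (2 * n) + n - n = 64 + l * (2 * n) by omega, Nat.testBit_mul_two_pow]
  simp; omega

/-- The salt is a 64-bit quantity. -/
theorem psalt_lt (L tg : ℕ) : psalt L tg < 2 ^ 64 := by
  unfold psalt; rw [mod_eq']; exact Nat.mod_lt _ (by norm_num)

/-- **The update is salt-blind above bit `64`**: `((M &&& (call ^^^ X)) ^^^ psalt)` at a position `i ≥ 64` with `call` set
is `M` and not `X`. -/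
theorem testBit_update {M X i L tg : ℕ} (hcall : (mkTC n K units).call.testBit i = true) (hi : 64 ≤ i) :
    (Nat.xor (Nat.land M (Nat.xor (mkTC n K units).call X)) (psalt L tg)).testBit i = (M.testBit i && !X.testBit i) := by
  rw [xor_eq, land_eq, xor_eq, Nat.testBit_xor, Nat.testBit_land, Nat.testBit_xor, hcall,
    Nat.testBit_lt_two_pow (lt_of_lt_of_le (psalt_lt L tg) (Nat.pow_le_pow_right Nat.two_pos hi))]
  cases M.testBit i <;> cases X.testBit i <;> rfl

/-- The same for the double mask of the first element (`X` then the cut `Y`). -/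
theorem testBit_update2 {M X Y i L tg : ℕ} (hcall : (mkTC n K units).call.testBit i = true) (hi : 64 ≤ i) :
    (Nat.xor (Nat.land (Nat.land M (Nat.xor (mkTC n K units).call X)) (Nat.xor (mkTC n K units).call Y))
        (psalt L tg)).testBit i = (M.testBit i && !X.testBit i && !Y.testBit i) := by
  rw [xor_eq, land_eq, land_eq, xor_eq, xor_eq, Nat.testBit_xor, Nat.testBit_land, Nat.testBit_land, Nat.testBit_xor,
    Nat.testBit_xor, hcall, Nat.testBit_lt_two_pow (lt_of_lt_of_le (psalt_lt L tg) (Nat.pow_le_pow_right Nat.two_pos hi))]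
  cases M.testBit i <;> cases X.testBit i <;> cases Y.testBit i <;> rfl

/-- **The patterns of a class.** With `EPup = (EP <<< upK) ||| PM` (`PM < 2^n`, `K ≥ 1`) and the sentinel
`sb = 2^{64 + lW + n}`: `((EPup / sb^K) &&& allKW) <<< 64` carries, at bit `64 + j`, bit `l·KW + j` of `EP` (`j < KW`). -/
theorem testBit_extract (hK : 1 ≤ K) (EP PM : ℕ) (hPM : PM < 2 ^ n) (l j : ℕ) :
    (Nat.shiftLeft (Nat.land (Nat.div (Nat.lor (Nat.shiftLeft EP (mkTC n K units).upK) PM)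
        (Nat.pow (2 ^ (64 + l * (2 * n) + n)) (mkTC n K units).K)) (mkTC n K units).allKW) 64).testBit (64 + j) =
      (decide (j < K * (2 * n)) && EP.testBit (l * (K * (2 * n)) + j)) := by
  have hm : (64 + l * (2 * n) + n) * K = K * (n + 64) + l * (K * (2 * n)) := by ring
  have hpow : Nat.pow (2 ^ (64 + l * (2 * n) + n)) K = 2 ^ (K * (n + 64) + l * (K * (2 * n))) := by
    rw [← hm]; exact (pow_mul 2 _ K).symm
  have hbig : n ≤ j + (K * (n + 64) + l * (K * (2 * n))) := by
    have : 1 * (n + 64) ≤ K * (n + 64) := Nat.mul_le_mul_right _ hK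
    omega
  rw [shiftLeft_eq', Nat.testBit_shiftLeft, decide_eq_true (show 64 + j ≥ 64 by omega), Bool.true_and,
    show 64 + j - 64 = j by omega, land_eq, Nat.testBit_land, mkTC_allKW, testBit_lowMask, Bool.and_comm, mkTC_upK,
    mkTC_K, hpow, div_eq', Nat.testBit_div_two_pow, lor_eq, Nat.testBit_lor, shiftLeft_eq', Nat.testBit_shiftLeft,
    Nat.testBit_lt_two_pow (lt_of_lt_of_le hPM (Nat.pow_le_pow_right Nat.two_pos hbig)), Bool.or_false,
    decide_eq_true (show j + (K * (n + 64) + l * (K * (2 * n))) ≥ K * (n + 64) by omega), Bool.true_and,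
    show j + (K * (n + 64) + l * (K * (2 * n))) - K * (n + 64) = l * (K * (2 * n)) + j by omega]

/-- … and nothing below bit `64`. -/
theorem testBit_extract_low (EPup sb i : ℕ) (hi : i < 64) :
    (Nat.shiftLeft (Nat.land (Nat.div EPup (Nat.pow sb (mkTC n K units).K)) (mkTC n K units).allKW) 64).testBit i =
      false := by
  rw [shiftLeft_eq', Nat.testBit_shiftLeft]; simp; omega

end Ops

/-! ## 5. The pattern builders: `dMask`, `ndMask`, `epOf`, `epAll` -/

section Patterns

variable {n K : ℕ} (units : List ℕ)

/-- `rot` stays below `2^n`. -/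
theorem rot_lt' (M t : ℕ) : rot n (lowMask n) M t < 2 ^ n := by
  unfold rot
  rw [land_eq]
  apply Nat.lt_pow_two_of_testBit
  intro i hi
  rw [Nat.testBit_land, testBit_lowMask]
  simp; omega

/-- A number whose bits at and above `m` are clear after `xor` with `1` (for `m ≥ 1`). -/
theorem xor_one_lt {x m : ℕ} (hx : x < 2 ^ m) (hm : 1 ≤ m) : Nat.xor x 1 < 2 ^ m := by
  have h1 : ∀ i, Nat.testBit 1 i = decide (i = 0) := fun i => by cases i <;> simp [Nat.testBit_succ]
  rw [xor_eq]
  apply Nat.lt_pow_two_of_testBit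
  intro i hi
  rw [Nat.testBit_xor, Nat.testBit_lt_two_pow (lt_of_lt_of_le hx (Nat.pow_le_pow_right Nat.two_pos hi)), h1]
  simp; omega

/-- `dMask` stays below `2^n` (`n ≥ 1`). -/
theorem dMask_lt (hn : 1 ≤ n) (PM t : ℕ) : dMask (mkTC n K units) PM t < 2 ^ n := by
  unfold dMask; rw [mkTC_n, mkTC_fulln]; exact xor_one_lt (rot_lt' _ _) hn

/-- `ndMask` stays below `2^n` (`n ≥ 1`). -/
theorem ndMask_lt (hn : 1 ≤ n) (NM t : ℕ) : ndMask (mkTC n K units) NM t < 2 ^ n := by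
  unfold ndMask; rw [mkTC_n, mkTC_fulln]; exact xor_one_lt (rot_lt' _ _) hn

/-- An OR of two numbers below `2^m` is below `2^m`. -/
theorem lor_lt {x y m : ℕ} (hx : x < 2 ^ m) (hy : y < 2 ^ m) : Nat.lor x y < 2 ^ m := by
  rw [lor_eq]; exact Nat.or_lt_two_pow hx hy

/-- The doubled lane `E ||| (E <<< n)` stays below `2^{2n}`. -/
theorem dbl_lt {E : ℕ} (hE : E < 2 ^ n) : Nat.lor E (Nat.shiftLeft E n) < 2 ^ (2 * n) := by
  rw [lor_eq, shiftLeft_eq']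
  apply Nat.lt_pow_two_of_testBit
  intro i hi
  rw [Nat.testBit_lor, Nat.testBit_shiftLeft, Nat.testBit_lt_two_pow (lt_of_lt_of_le hE (Nat.pow_le_pow_right Nat.two_pos (by omega))),
    Nat.testBit_lt_two_pow (lt_of_lt_of_le hE (Nat.pow_le_pow_right Nat.two_pos (by omega)))]
  simp

/-- Bits of the doubled lane `E ||| (E <<< n)`. -/
theorem testBit_dbl {E j : ℕ} (hE : E < 2 ^ n) :
    (Nat.lor E (Nat.shiftLeft E n)).testBit j = E.testBit (if j < n then j else j - n) := by
  rw [lor_eq, shiftLeft_eq', Nat.testBit_lor, Nat.testBit_shiftLeft]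
  by_cases h : j < n
  · rw [if_pos h]; have : ¬ (j ≥ n) := by omega
    simp [this]
  · rw [if_neg h, Nat.testBit_lt_two_pow (lt_of_lt_of_le hE (Nat.pow_le_pow_right Nat.two_pos (by omega)))]
    have : j ≥ n := by omega
    simp [this]

/-- The entry of lane `l'` of the patterns of the class with code `t`: `(D(t) ∪ {0}) ∪ −D(code_{l'})`. -/
noncomputable def entry (c : TC) (PM NM OC t l' : ℕ) : ℕ := Nat.lor (Nat.lor (dMask c PM t) 1) (ndMask c NM (codeAt OC l'))

/-- An entry stays below `2^n`. -/
theorem entry_lt (hn : 1 ≤ n) (PM NM OC t l' : ℕ) : entry (mkTC n K units) PM NM OC t l' < 2 ^ n :=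
  lor_lt (lor_lt (dMask_lt units hn _ _) (Nat.one_lt_two_pow (by omega))) (ndMask_lt units hn _ _)

/-- `epOf` is the lane fold of the doubled entries. -/
theorem epOf_eq (c : TC) (PM NM OC t : ℕ) :
    epOf c PM NM OC t = foldLanes c.K c.W (fun l' => Nat.lor (entry c PM NM OC t l') (Nat.shiftLeft (entry c PM NM OC t l') c.n)) := by
  unfold epOf foldLanes entry
  rw [force_eq]
  congr 1
  funext l acc
  rw [force_eq, force_eq, force_eq]

/-- `epAll` is the lane fold (width `KW`) of the `epOf`. -/
theorem epAll_eq (c : TC) (PM NM OC : ℕ) :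
    epAll c PM NM OC = foldLanes c.K c.KW (fun j => epOf c PM NM OC (codeAt OC j)) := by
  unfold epAll foldLanes
  congr 1
  funext j acc
  rw [force_eq, force_eq, force_eq]

/-- `epOf` stays below `2^{KW}`. -/
theorem epOf_lt (hn : 1 ≤ n) (PM NM OC t : ℕ) : epOf (mkTC n K units) PM NM OC t < 2 ^ (K * (2 * n)) := by
  rw [epOf_eq, mkTC_K, mkTC_W]
  exact foldLanes_lt _ _ (by omega) _ fun l' => by rw [mkTC_n]; exact dbl_lt (entry_lt units hn _ _ _ _ _)

/-- **Bits of `epAll`**: bit `l·KW + (l'·W + j)` (`l, l' < K`, `j < 2n`) is bit `j mod n`-ish of the entry `(l, l')`. -/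
theorem testBit_epAll (hn : 1 ≤ n) (PM NM OC : ℕ) {l l' j : ℕ} (hl : l < K) (hl' : l' < K) (hj : j < 2 * n) :
    (epAll (mkTC n K units) PM NM OC).testBit (l * (K * (2 * n)) + (l' * (2 * n) + j)) =
      (entry (mkTC n K units) PM NM OC (codeAt OC l) l').testBit (if j < n then j else j - n) := by
  have hW : 0 < 2 * n := by omega
  have hKW : 0 < K * (2 * n) := Nat.mul_pos (by omega) hW
  have hin : l' * (2 * n) + j < K * (2 * n) := lane_lt hl' hj
  rw [epAll_eq, mkTC_K, mkTC_KW, testBit_foldLanes _ hKW _ (fun j => epOf_lt units hn _ _ _ _),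
    (div_mod_block hin).1, (div_mod_block hin).2, epOf_eq, mkTC_K, mkTC_W, mkTC_n,
    testBit_foldLanes _ hW _ (fun l'' => dbl_lt (entry_lt units hn _ _ _ _ _)), (div_mod_block hj).1, (div_mod_block hj).2,
    testBit_dbl (entry_lt units hn _ _ _ _ _)]
  have h1 : l * (K * (2 * n)) + (l' * (2 * n) + j) < K * (K * (2 * n)) := lane_lt hl hin
  simp [hin, h1]

/-- **Meaning of an entry bit** (`d < n`, codes `< n`, `PM < 2^n`, `NM < 2^n`): `d = 0`, or `PM` has bit `(d + t) mod n`
(`d ∈ T − t`), or `NM` has bit `(d + n − t') mod n` (`d ∈ t' − T`, `t' = code_{l'}`). -/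
theorem entry_sound {PM NM OC t l' d : ℕ} (hPM : PM < 2 ^ n) (hNM : NM < 2 ^ n) (ht : t < n) (ht' : codeAt OC l' < n)
    (hd : d < n) (h : (entry (mkTC n K units) PM NM OC t l').testBit d = true) :
    d = 0 ∨ PM.testBit ((d + t) % n) = true ∨ NM.testBit ((d + (n - codeAt OC l')) % n) = true := by
  by_cases hd0 : d = 0
  · exact Or.inl hd0
  have h1 : ∀ i, Nat.testBit 1 i = decide (i = 0) := fun i => by cases i <;> simp [Nat.testBit_succ]
  unfold entry dMask ndMask at h
  rw [mkTC_n, mkTC_fulln, lor_eq, lor_eq, xor_eq, xor_eq, Nat.testBit_lor, Nat.testBit_lor, Nat.testBit_xor,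
    Nat.testBit_xor, h1, mod_eq', sub_eq'] at h
  have hd0' : decide (d = 0) = false := by simp [hd0]
  rw [hd0', Bool.xor_false, Bool.xor_false, Bool.or_false] at h
  rw [Bool.or_eq_true] at h
  rcases h with h | h
  · -- D(t): rotation of PM by (n - t) % n
    right; left
    have hs : (n - t) % n ≤ n := le_of_lt (Nat.mod_lt _ (by omega))
    rw [testBit_rot hPM hs hd] at h
    by_cases ht0 : t = 0
    · subst ht0
      simp only [Nat.sub_zero, Nat.mod_self, zero_le, if_true] at h
      rw [Nat.add_zero, Nat.mod_eq_of_lt hd]; simpa using h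
    · have hs' : (n - t) % n = n - t := Nat.mod_eq_of_lt (by omega)
      rw [hs'] at h
      by_cases hc : n - t ≤ d
      · rw [if_pos hc] at h
        have : (d + t) % n = d - (n - t) := by
          rw [show d + t = (d + t - n) + n by omega, Nat.add_mod_right, Nat.mod_eq_of_lt (by omega)]; omega
        rw [this]; exact h
      · rw [if_neg hc] at h
        have : (d + t) % n = d + (n - (n - t)) := by rw [Nat.mod_eq_of_lt (by omega)]; omega
        rw [this]; exact h
  · -- −D(t'): rotation of NM by t'
    right; right
    rw [testBit_rot hNM (le_of_lt ht') hd] at h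
    by_cases hc : codeAt OC l' ≤ d
    · rw [if_pos hc] at h
      have : (d + (n - codeAt OC l')) % n = d - codeAt OC l' := by
        rw [show d + (n - codeAt OC l') = (d - codeAt OC l') + n by omega, Nat.add_mod_right, Nat.mod_eq_of_lt (by omega)]
      rw [this]; exact h
    · rw [if_neg hc] at h
      have : (d + (n - codeAt OC l')) % n = d + (n - codeAt OC l') := Nat.mod_eq_of_lt (by omega)
      rw [this]; exact h

/-- Bits of `negMask`: negated codes of the list. -/
theorem negMask_sound (c : TC) (L : List ℕ) {x : ℕ} (h : (negMask c L).testBit x = true) :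
    ∃ t ∈ L, x = (c.n - t) % c.n := by
  induction L with
  | nil => simp [negMask] at h
  | cons t tl ih =>
      have h' : (Nat.lor (negMask c tl) (Nat.shiftLeft 1 (Nat.mod (Nat.sub c.n t) c.n))).testBit x = true := h
      rw [lor_eq, shiftLeft_eq', Nat.testBit_lor, Nat.one_shiftLeft, Nat.testBit_two_pow, Bool.or_eq_true] at h'
      rcases h' with h1 | h2
      · obtain ⟨t', ht', hx⟩ := ih h1
        exact ⟨t', by simp [ht'], hx⟩
      · exact ⟨t, by simp, by simpa [mod_eq', sub_eq'] using (of_decide_eq_true h2).symm⟩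

/-- `negMask` stays below `2^n` (`n ≥ 1`). -/
theorem negMask_lt (hn : 1 ≤ n) (L : List ℕ) : negMask (mkTC n K units) L < 2 ^ n := by
  apply Nat.lt_pow_two_of_testBit
  intro i hi
  by_contra h
  rw [Bool.not_eq_false] at h
  obtain ⟨t, -, hx⟩ := negMask_sound _ L h
  rw [mkTC_n] at hx
  have := Nat.mod_lt (n - t) (show 0 < n by omega)
  omega

/-- `maskL` of codes `< n` stays below `2^n`. -/
theorem maskL_lt (L : List ℕ) (hL : ∀ t ∈ L, t < n) : maskL L < 2 ^ n := by
  apply Nat.lt_pow_two_of_testBit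
  intro i hi
  rw [testBit_maskL]
  have : i ∉ L := fun h => by have := hL i h; omega
  simp [this]

end Patterns

end STPP211T

end Summit.MatrixMultiplication.OmegaCensus
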